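import Summits.ResolutionOfSingularities.ResolutionOfSingularities.Theorems.FrobeniusClosingPatchingRelPerfectPointBlowupChartAssembly
import Literature.AlgebraicGeometry.Resolution.QuadraticTransformWeakTransform
import HarnessLib

/-!
# Crux `PatchingRelPerfect` (stmt-ResolutionOfSingularities-16161), chain w52 — CORE RUNG r1t:
# the TANGENT-CONE rung — `I ⊆ 𝔪ᵈ` whose degree-`d` part cuts a regular centre out of every
# Rees chart of `Bl_𝔪` has companion `𝔪`

[OURS · L1 W5.2 · rung] CHAIN.md v1.2 §2 (row stub-4) asks for the general form of rung r1c with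
the linear centre replaced by the tangent cone, in Proj-free typing.  Let `S` be regular local
with minimal basis `x = (x₁, …, x_n)` of `𝔪`, `B_i = (S[𝔪t])_{(x_i t)}` the Rees charts of
`B = Bl_𝔪 Spec S` (`chartRing x i`, structure map `ψ_i = chartBase x i`), and `I ⊆ 𝔪ᵈ` a non-zero
ideal.  On `B_i` one has `𝔪ᵈ · B_i = (x_iᵈ)`, hence (`eq_span_singleton_mul_colon`)

  `I · B_i = x_iᵈ · 𝔫_i`,  `𝔫_i := (I · B_i : x_iᵈ)` — the ideal of the (chart of the) total
  transform's residual centre, cut out modulo `x_i` by the dehomogenised degree-`d` initial forms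
  of `I` (the projectivised tangent cone `ℙ(C_I) ∩ D₊(x_i t)` when `x_i^{d+1} ∈ I`).

**Rung r1t** (`coreRung_tangentCone`): if every `B_i ⧸ 𝔫_i` is a regular ring, then the companion
`Q = 𝔪` works — `Bl_{I·𝔪} = Bl_{I·𝒪_B} B` is, chart by chart, the blow-up of the regular `B_i`
along the regular centre `𝔫_i` twisted by the Cartier divisor `x_iᵈ` (Liu 8.1.19 (a),
`isRegular_of_isBlowup_idealSheaf_span_singleton_mul`), assembled by
`atomConclusion_of_pointBlowup_charts` — so every blow-up `T = Bl_I Spec S` satisfies the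
conclusion of the blow-up-form core `AtomDimFourBlowupAt`.  Rung r1c (`I = 𝔪² + (z)`:
`𝔫_i = (x_i, z/x_i)` or `B_i`) and every "smooth initial form" member (e.g. `𝔪^{d+1} + (q)` with
`q̄ = 0` a smooth hypersurface of `ℙ^{n-1}_κ` meeting the charts regularly) are instances; the
regularity of `B_i ⧸ 𝔫_i` is the ONLY input, to be discharged member by member (for r1c by
`isRegularRing_quot_chartIdeal`).  Every regular local `S`, every dimension, every `d`.
BC5-type FORMAT evidence; nothing here is a statement of the manuscript under review.

* `map_chartBase_eq_pow_mul_colon` (with the tree's `eq_span_singleton_mul_colon`: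
  `J ⊆ (a) ⇒ J = (a) · (J : a)`) — `I · B_i = x_iᵈ · (I · B_i : x_iᵈ)` for `I ⊆ 𝔪ᵈ`;
* `isRegular_of_isBlowup_chart_tangentCone` — the chart statement;
* `coreRung_tangentCone` — the rung (companion `𝔪`); `atomDimFourBlowupAt_tangentCone` — the
  registered core's binder shape restricted to the family.

## References

* The Stacks Project, Tags 080A, 080B, 0804. [StacksProject]
* Q. Liu, *Algebraic Geometry and Arithmetic Curves*, OUP 2002, Thm. 8.1.19 (a). [Liu2002]
-/

-- `Summit.<Summit>.<Sub>.Theorems` with `Sub = Summit` (single-conjunct summit, D-0017)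
set_option linter.dupNamespace false

noncomputable section

open CategoryTheory CategoryTheory.Limits AlgebraicGeometry Literature.AlgebraicGeometry.Resolution
open scoped Pointwise

namespace Summit.ResolutionOfSingularities.ResolutionOfSingularities.Theorems

universe u

section Charts

variable {S : Type u} [CommRing S] {n : ℕ} (x : Fin n → S)

/-- **On the chart `D₊(x_i t)` of `Bl_{(x)}`, an ideal `I ⊆ (x)ᵈ` factors as
`I · B_i = x_iᵈ · (I · B_i : x_iᵈ)`** (`(x)ᵈ · B_i = (x_iᵈ)`). [cite: StacksProject, Tag 0804] -/
theorem map_chartBase_eq_pow_mul_colon (i : Fin n) {I : Ideal S} {d : ℕ}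
    (hId : I ≤ Ideal.span (Set.range x) ^ d) :
    I.map (chartBase x i) = Ideal.span {chartBase x i (x i) ^ d} *
      (I.map (chartBase x i)).colon {chartBase x i (x i) ^ d} := by
  refine eq_span_singleton_mul_colon ?_
  have h := Ideal.map_mono (f := chartBase x i) hId
  rwa [Ideal.map_pow, map_reesChartBase_eq (x i) (Ideal.mem_span_range_self (f := x) (x := i)),
    Ideal.span_singleton_pow] at h

variable [IsRegularLocalRing S] (hx : Ideal.span (Set.range x) = IsLocalRing.maximalIdeal S)
  (hd : (IsLocalRing.maximalIdeal S).spanFinrank = n)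

include hx hd in
/-- **Chart statement of the tangent-cone rung**: if `I ⊆ 𝔪ᵈ` and `B_i ⧸ (I · B_i : x_iᵈ)` is a
regular ring, every blow-up of the chart `Spec B_i` along `I · B_i` is regular (twist off `x_iᵈ`,
then Liu 8.1.19 (a)). [cite: Liu2002, Thm. 8.1.19 (a)] [cite: StacksProject, Tag 080B (proof)] -/
theorem isRegular_of_isBlowup_chart_tangentCone (i : Fin n) {I : Ideal S} {d : ℕ}
    (hId : I ≤ IsLocalRing.maximalIdeal S ^ d)
    [IsRegularRing (chartRing x i ⧸ (I.map (chartBase x i)).colon {chartBase x i (x i) ^ d})]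
    {Y : Scheme.{u}} {ρ : Y ⟶ Spec (.of (chartRing x i))}
    (hρ : IsBlowup ρ (affineBlowup.idealSheaf (I.map (chartBase x i)))) : Scheme.IsRegular Y := by
  have hsurj : Function.Surjective (Fin.cast (Nat.add_zero n)) :=
    (finCongr (Nat.add_zero n)).surjective
  have hz' : Ideal.span (Set.range (Fin.append x Fin.elim0)) = IsLocalRing.maximalIdeal S := by
    rw [Fin.append_elim0, hsurj.range_comp]; exact hx
  have hd' : (IsLocalRing.maximalIdeal S).spanFinrank = n + 0 := hd
  haveI : IsRegularRing S := isRegularRing_of_isRegularLocalRing S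
  haveI : IsRegularRing (S ⧸ Ideal.span (Set.range x)) := by
    haveI := isRegularLocalRing_quot_centre x Fin.elim0 hz' hd'
    exact isRegularRing_of_isRegularLocalRing _
  haveI : IsRegularRing (chartRing x i) :=
    isRegularRing_blowupChart x i (isQuasiRegular_centre x Fin.elim0 hz' hd')
  rw [← hx] at hId
  rw [map_chartBase_eq_pow_mul_colon x i hId] at hρ
  exact isRegular_of_isBlowup_idealSheaf_span_singleton_mul
    (pow_mem (reesChartBase_mem_nonZeroDivisors (x i)
      (Ideal.mem_span_range_self (f := x) (x := i))) d) _ hρ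

include hx hd in
/-- **CORE RUNG r1t (tangent-cone rung).** `S` regular local with minimal basis `x` of `𝔪`,
`I ≠ 0`, `I ⊆ 𝔪ᵈ`; if on every Rees chart `B_i` of `Bl_𝔪 Spec S` the residual centre
`𝔫_i = (I · B_i : x_iᵈ)` has a regular quotient `B_i ⧸ 𝔫_i`, then every blow-up `T = Bl_I Spec S`
carries a non-zero ideal sheaf cosupported in the closed fibre with regular blowing up — the
companion `Q = 𝔪` of W2 (`Bl_{I·𝔪}` regular: `Bl_𝔪`, then chart by chart the regular centre
`𝔫_i` twisted by `x_iᵈ`).  Every dimension, every regular local base; the conclusion is that of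
the blow-up-form core `AtomDimFourBlowupAt`. [cite: StacksProject, Tag 080A]
[cite: Liu2002, Thm. 8.1.19 (a)] -/
theorem coreRung_tangentCone {I : Ideal S} (hI : I ≠ ⊥) {d : ℕ}
    (hId : I ≤ IsLocalRing.maximalIdeal S ^ d)
    (hreg : ∀ i : Fin n, IsRegularRing
      (chartRing x i ⧸ (I.map (chartBase x i)).colon {chartBase x i (x i) ^ d}))
    (T : Scheme.{u}) (f : T ⟶ Spec (.of S)) (hf : IsBlowup f (affineBlowup.idealSheaf I)) :
    ∃ (J : T.IdealSheafData) (T' : Scheme.{u}) (π : T' ⟶ T), J ≠ ⊥ ∧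
      (∀ t : T, t ∈ J.support → f.base t = IsLocalRing.closedPoint S) ∧
      IsBlowup π J ∧ Scheme.IsRegular T' := by
  by_cases h𝔪 : IsLocalRing.maximalIdeal S = ⊥
  · -- `S` is a field: `I = S`, the blow-up is an isomorphism (rung r0')
    have hItop : I = ⊤ := by
      by_contra h
      exact hI (eq_bot_iff.mpr ((IsLocalRing.le_maximalIdeal h).trans h𝔪.le))
    subst hItop
    rw [← Ideal.span_singleton_one] at hf
    exact coreRung_span_singleton one_ne_zero T f hf
  · refine atomConclusion_of_pointBlowup_charts x hx h𝔪 hI (Q₀ := ⊤) (N := 0) le_top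
      (fun i Y ρ hρ => ?_) T f hf
    rw [Ideal.mul_top] at hρ
    haveI := hreg i
    exact isRegular_of_isBlowup_chart_tangentCone x hx hd i hId hρ

/-- **The registered core's binder shape, restricted to the tangent-cone family** (hypotheses of
`stub_atomDimFourBlowup` plus the chart-regularity input; dimension, characteristic,
completeness, residue field and the off-fibre hypothesis unused).
[cite: StacksProject, Tag 080A] [cite: Liu2002, Thm. 8.1.19 (a)] -/
theorem atomDimFourBlowupAt_tangentCone (p : ℕ) (_hp : p.Prime) (S : Type) [CommRing S]
    [IsRegularLocalRing S] [CharP S p] [IsAdicComplete (IsLocalRing.maximalIdeal S) S]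
    [PerfectField (IsLocalRing.ResidueField S)] (_hS : ringKrullDim S = (4 : ℕ))
    {n : ℕ} (x : Fin n → S) (hx : Ideal.span (Set.range x) = IsLocalRing.maximalIdeal S)
    (hd : (IsLocalRing.maximalIdeal S).spanFinrank = n)
    (I : Ideal S) (hI : I ≠ ⊥) {d : ℕ} (hId : I ≤ IsLocalRing.maximalIdeal S ^ d)
    (hreg : ∀ i : Fin n, IsRegularRing
      (chartRing x i ⧸ (I.map (chartBase x i)).colon {chartBase x i (x i) ^ d}))
    (T : Scheme.{0}) (f : T ⟶ Spec (.of S)) (hf : IsBlowup f (affineBlowup.idealSheaf I))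
    (_hoff : ∀ t : T, f.base t ≠ IsLocalRing.closedPoint S →
      IsRegularLocalRing (T.presheaf.stalk t)) :
    ∃ (J : T.IdealSheafData) (T' : Scheme.{0}) (π : T' ⟶ T), J ≠ ⊥ ∧
      (∀ t : T, t ∈ J.support → f.base t = IsLocalRing.closedPoint S) ∧
      IsBlowup π J ∧ Scheme.IsRegular T' :=
  coreRung_tangentCone x hx hd hI hId hreg T f hf

end Charts

end Summit.ResolutionOfSingularities.ResolutionOfSingularities.Theorems

end
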